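import Summits.CriticalPhenomena.CardyFormulaZ2.Theorems.CardyUSTContinuationKirchhoffExtremalLengthG02BdryValue
import Summits.CriticalPhenomena.CardyFormulaZ2.Theorems.CardyUSTContinuationKirchhoffExtremalLengthG02Current
import Summits.CriticalPhenomena.CardyFormulaZ2.Theorems.CardyUSTContinuationKirchhoffExtremalLengthG02Holo3
import Summits.CriticalPhenomena.CardyFormulaZ2.Theorems.CardyUSTContinuationKirchhoffExtremalLengthG02CrossExits

/-!
# `lim sup_{δ → 0⁺} 𝒞(A_δ ↔ B_δ; Ω_δ) ≤ d_Ω((ab),(cd))⁻¹` for the `meshDomain`/`discreteArc`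
# discretisation of every conformal rectangle (the second half of `G02ModulusConvergence`)

Support file for `KirchhoffExtremalLength` (route CardyUSTContinuation of `CardyFormulaZ2`, item
stmt-CriticalPhenomena-11234). Transposition of the tree's
`SquareTiling.le_inv_extremalDistance_of_subseq` ([GP19] Thm 4.6 + the duality argument on `ℤ²`,
Cor 4.15, lower half for the resistances) from the Georgakopoulos–Panagiotis graph along dyadic
meshes to `Ω_δ = discreteDomainGraph Ω δ` along EVERY sequence of meshes `δ_n → 0⁺` at which the
discrete arcs are disjoint: if the conductances converge to `I` then `I ≤ d_Ω((ab),(cd))⁻¹`.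
The discrete inputs are the G02 files of this series (`exists_holomorphic_limit'`,
`exists_boundary_value'`, `exists_exits_flux_eq'`, `sum_divAt_eq_toReal_conductance'`); the
continuum steps (uniformizing rectangle, cross data, exterior closing curves, rectangle energy
inequality, conformal invariance of the Dirichlet energy) are the tree's.
-/

noncomputable section

namespace Summit.CriticalPhenomena.CardyFormulaZ2.Theorems

namespace KirchhoffSlope

open Set Metric Filter Topology SimpleGraph MeasureTheory Complex
open scoped ENNReal NNReal
open Literature.Probability Literature.Probability.LatticeModels Literature.Probability.Percolation
open Literature.Probability.LatticeModels.SquareTiling (closedSq dist_le_of_mem_closedSq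
  exists_rect_uniformizer extremalDistance_arc_le exists_cross_data cross_separation exists_exterior_curves
  openArc_subset_arc openArc_disjoint_arc boundaryLimit_unique eq_of_locallyConstant_Ioo
  ofReal_sq_sub_mul_div_le_lintegral_rect lintegral_deriv_comp_sq_eq openArc)
open Literature.Probability.RandomPlanarGeometry Literature.Analysis.Complex

set_option maxHeartbeats 3200000 in
open Classical in
/-- **[GP19] Theorem 4.6 + the duality argument, lower half**: along any subsequence of the
dyadic meshes with `𝒞(T_n ↔ B_n) → I` we have `I ≤ d_Ω(T, B)⁻¹`; hence
`lim inf_n R^eff_n ≥ d_Ω(T, B)`. Proof (on `ℤ²`, without planar duality): extract the holomorphic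
limit `f = u + iv` of the conjugate pairs (`exists_holomorphic_limit`, `∫∫_Ω ‖f'‖² ≤ I`); the
flux across the crosscut identifies the jump of the boundary values of `u` between the open
arcs `1` and `3` with `±I` (`exists_exits_flux_eq`, `exists_boundary_value`,
`sum_divAt_eq_toReal_conductance`); transporting to the uniformizing rectangle
(`exists_rect_uniformizer`, `lintegral_deriv_comp_sq_eq`) the rectangle energy inequality
(`ofReal_sq_sub_mul_div_le_lintegral_rect`) gives `I² · a/b ≤ I`, and `d_Ω(arc 0, arc 2) ≤ a/b`
(`extremalDistance_arc_le`). [cite: GeorgakopoulosPanagiotis2019, Theorem 4.6 and Corollary 4.15] -/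
theorem le_inv_extremalDistance_of_subseq_of_disjoint' (R : ConformalRectangle) {δs : ℕ → ℝ}
    (hδ : ∀ n, 0 < δs n) (hδ0 : Tendsto δs atTop (𝓝 0))
    (hdisj : ∀ n, discreteArc R.carrier (δs n) (R.arc 0) ∩ discreteArc R.carrier (δs n) (R.arc 2) = ∅)
    {I : ℝ≥0∞}
    (hI : Tendsto (fun n => effectiveConductance (discreteDomainGraph R.carrier (δs n)) 1
      (discreteArc R.carrier (δs n) (R.arc 0)) (discreteArc R.carrier (δs n) (R.arc 2))) atTop (𝓝 I)) :
    I ≤ (Literature.Analysis.Complex.extremalDistance R.carrier (R.arc 0) (R.arc 2))⁻¹ := by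
  have hΩo : IsOpen R.carrier := R.isOpen
  have hfrΩ : ∀ z ∈ frontier R.carrier, z ∉ R.carrier := fun z hz hzΩ =>
    Set.disjoint_left.1 R.disjoint_carrier_frontier hzΩ hz
  -- ### Step 0: `I` is finite
  obtain ⟨K, hK⟩ := eventually_effectiveConductance_discreteArc_le R
  have hδw : Tendsto δs atTop (𝓝[>] 0) := tendsto_nhdsWithin_iff.2 ⟨hδ0, Eventually.of_forall fun n => hδ n⟩
  have hCK : ∀ᶠ n in atTop, effectiveConductance (discreteDomainGraph R.carrier (δs n)) 1
      (discreteArc R.carrier (δs n) (R.arc 0)) (discreteArc R.carrier (δs n) (R.arc 2)) ≤ K :=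
    hδw.eventually hK
  have hIK : I ≤ K := le_of_tendsto hI hCK
  have hItop : I ≠ ⊤ := ne_top_of_le_ne_top ENNReal.coe_ne_top hIK
  set Ir : ℝ := I.toReal with hIrdef
  have hIr : I = ENNReal.ofReal Ir := (ENNReal.ofReal_toReal hItop).symm
  have hIr0 : 0 ≤ Ir := ENNReal.toReal_nonneg
  -- ### Step 1: the uniformizing rectangle
  obtain ⟨a, b, ha, hb, Ψ, jL, jR, hΨc, hΨinj, hΨcl, hΨimg, hΨd, hΨ', hLR, hLcl, hRcl, hLo, hRo, hBo, hTo⟩ := exists_rect_uniformizer R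
  have hlam : Literature.Analysis.Complex.extremalDistance R.carrier (R.arc 0) (R.arc 2) ≤ ENNReal.ofReal (a / b) :=
    extremalDistance_arc_le R ha hb hΨc hΨinj hΨimg hΨd hLR hLcl hRcl
  -- ### Step 2: the cross
  obtain ⟨ΓV, ΓH, c₀, r, xs, ys, tᵢ, tₒ, sᵢ, sₒ, hVc, hHc, hV0, hV1, hH0, hH1, hVΩ, hHΩ, hmeet, -, -, hVarc, hr, hball,
    htᵢ, htᵢ', htₒ', htₒ, hsᵢ, hsᵢ', hsₒ', hsₒ, hnVi, hnVo, hnHi, hnHo, houtV1, houtV2, houtH1, houtH2, hclVi, hclVo, hclHi, hclHo,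
    hxs, hys, -, -⟩ := exists_cross_data R ha hb hΨc hΨinj hΨimg hΨd hΨ' hLo hRo hBo hTo
  have hc : (⟨xs, ys⟩ : ℂ) ∈ R.carrier := by
    refine hball (mem_closedBall.2 ?_)
    rw [Complex.dist_eq]
    refine (Complex.norm_le_abs_re_add_abs_im _).trans ?_
    have e1 : ((⟨xs, ys⟩ : ℂ) - c₀).re = xs - c₀.re := by simp
    have e2 : ((⟨xs, ys⟩ : ℂ) - c₀).im = ys - c₀.im := by simp
    rw [e1, e2]
    linarith [hxs.le, hys.le]
  -- ### Step 3: separation of the pieces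
  obtain ⟨hdisjA, hdisjB, hA234, hB234⟩ := cross_separation hmeet hr htᵢ htᵢ' htₒ' htₒ hsᵢ hsᵢ' hsₒ' hsₒ hnVi hnVo hnHi hnHo
    houtV1 houtV2 houtH1 houtH2 hclVi hclVo hclHi hclHo hxs hys
  -- ### Step 4: exterior closing curves
  have hqbfr : ΓV 0 ∈ frontier R.carrier := R.arc_subset_frontier 1 (openArc_subset_arc R 1 hV0)
  have hqtfr : ΓV 1 ∈ frontier R.carrier := R.arc_subset_frontier 3 (openArc_subset_arc R 3 hV1)
  obtain ⟨Et, Eb, M, hEtc, hEbc, hMc, hEt1, hEb1, hEt, hEb, hM, hM0, hM1⟩ :=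
    exists_exterior_curves R.toJordanDomain hqtfr hqbfr
  -- ### Step 5: the holomorphic limit
  obtain ⟨h, hprops, φ, hφ, f, hfd, hfint, hfconv⟩ := exists_holomorphic_limit' R hδ hδ0 hdisj hI hc
  set δ' : ℕ → ℝ := fun n => δs (φ n) with hδ's
  have hδ' : ∀ n, 0 < δ' n := fun n => hδ _
  have hδ'0 : Tendsto δ' atTop (𝓝 0) := hδ0.comp hφ.tendsto_atTop
  have hT := fun n => (hprops (φ n)).1
  have hB := fun n => (hprops (φ n)).2.1
  have h01 := fun n => (hprops (φ n)).2.2.1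
  have hE := fun n => (hprops (φ n)).2.2.2.1
  have hharm := fun n => (hprops (φ n)).2.2.2.2
  have hCφ : Tendsto (fun n => effectiveConductance (discreteDomainGraph R.carrier (δ' n)) 1
      (discreteArc R.carrier (δ' n) (R.arc 0)) (discreteArc R.carrier (δ' n) (R.arc 2))) atTop (𝓝 I) := hI.comp hφ.tendsto_atTop
  have hCφr : Tendsto (fun n => (effectiveConductance (discreteDomainGraph R.carrier (δ' n)) 1
      (discreteArc R.carrier (δ' n) (R.arc 0)) (discreteArc R.carrier (δ' n) (R.arc 2))).toReal) atTop (𝓝 Ir) :=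
    (ENNReal.tendsto_toReal hItop).comp hCφ
  -- ### Step 6: the energies are eventually bounded
  have hEn : ∀ᶠ n in atTop, ∑ e ∈ (edgeSet_discreteDomainGraph_finite R.isBounded (hδ' n)).toFinset, sqIncr (h (φ n)) e ≤ (K : ℝ) := by
    filter_upwards [hφ.tendsto_atTop.eventually hCK] with n hn
    have h1 : ENNReal.ofReal (∑ e ∈ (edgeSet_discreteDomainGraph_finite R.isBounded (hδ' n)).toFinset, sqIncr (h (φ n)) e) ≤
        networkEnergy (discreteDomainGraph R.carrier (δ' n)) 1 (h (φ n)) := by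
      have := ofReal_sum_le_networkEnergy (G := discreteDomainGraph R.carrier (δ' n)) (c := 1) (h (φ n))
        (S := (edgeSet_discreteDomainGraph_finite R.isBounded (hδ' n)).toFinset) (fun e he => (Set.Finite.mem_toFinset _).1 he)
      simpa using this
    rw [hE n] at h1
    have h2 := h1.trans hn
    have hsum0 : 0 ≤ ∑ e ∈ (edgeSet_discreteDomainGraph_finite R.isBounded (hδ' n)).toFinset, sqIncr (h (φ n)) e :=
      Finset.sum_nonneg fun e _ => sqIncr_nonneg _ _
    exact (ENNReal.ofReal_le_iff_le_toReal ENNReal.coe_ne_top).1 h2 |>.trans (by simp)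
  -- ### Step 7: boundary values (`exists_boundary_value`)
  have hD10 := fun (D : ℝ) (hD : 0 < D) => exists_boundary_value' R hδ' hδ'0 (h := fun n => h (φ n)) h01 hharm hEn hc
    (u := fun w => (f w).re) hfconv hD
  -- ### Step 8: the boundary values are constant along the open arcs `1` and `3`
  set arcs : Set ℂ := R.arc 0 ∪ R.arc 2 with harcs
  have harcs_closed : IsClosed arcs := (R.isClosed_arc 0).union (R.isClosed_arc 2)
  have harcs_ne : arcs.Nonempty := ⟨R.pt 0, Or.inl (R.pt_mem_arc_self 0)⟩
  -- boundary points of the open arcs `1`, `3` are off `arcs`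
  have hoff : ∀ i : Fin 4, (i = 1 ∨ i = 3) → ∀ s ∈ Ioo (R.mark i) (R.nextMark i), R.boundary s ∉ arcs := by
    intro i hi s hs hmem
    have hq : R.boundary s ∈ openArc R i := ⟨s, hs, rfl⟩
    rcases hmem with h' | h'
    · exact Set.disjoint_left.1 (openArc_disjoint_arc R (i := i) (j := 0) (by rcases hi with rfl | rfl <;> decide)) hq h'
    · exact Set.disjoint_left.1 (openArc_disjoint_arc R (i := i) (j := 2) (by rcases hi with rfl | rfl <;> decide)) hq h'
  have hDpos : ∀ {q : ℂ}, q ∉ arcs → 0 < infDist q arcs := fun hq =>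
    (infDist_pos_iff_notMem_closure harcs_ne).1 (by rwa [harcs_closed.closure_eq])
  -- the boundary-limit predicate and the limit function
  set P : ℂ → ℝ → Prop := fun q U => ∀ η > 0, ∃ r > 0, ∀ w ∈ R.carrier, dist w q < r → |(f w).re - U| ≤ η with hP
  have hPex : ∀ {s : ℝ}, R.boundary s ∉ arcs → ∃ U, P (R.boundary s) U := by
    intro s hs
    obtain ⟨ra, -, hra⟩ := hD10 _ (hDpos hs)
    obtain ⟨U, c, -, hbv, -, -⟩ := hra s fun y hy => infDist_le_dist_of_mem hy
    exact ⟨U, hbv⟩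
  set Ulim : ℂ → ℝ := fun q => if hq : ∃ U, P q U then Classical.choose hq else 0 with hUlim
  have hUlimP : ∀ {s : ℝ}, R.boundary s ∉ arcs → P (R.boundary s) (Ulim (R.boundary s)) := by
    intro s hs
    have hex := hPex hs
    simp only [hUlim, dif_pos hex]
    exact Classical.choose_spec hex
  have hcl : ∀ s : ℝ, R.boundary s ∈ closure R.carrier := fun s => frontier_subset_closure (R.boundary_mem_frontier s)
  have hUuniq : ∀ {s : ℝ} {U : ℝ}, R.boundary s ∉ arcs → P (R.boundary s) U → U = Ulim (R.boundary s) :=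
    fun hs hU => boundaryLimit_unique (hcl _) hU (hUlimP hs)
  -- local constancy along an open arc off `arcs`
  have hloc : ∀ i : Fin 4, (i = 1 ∨ i = 3) → ∀ s₀ ∈ Ioo (R.mark i) (R.nextMark i), ∃ ε > 0,
      ∀ s ∈ Ioo (R.mark i) (R.nextMark i), |s - s₀| < ε → Ulim (R.boundary s) = Ulim (R.boundary s₀) := by
    intro i hi s₀ hs₀
    set q₀ := R.boundary s₀ with hq₀
    have hq₀off := hoff i hi s₀ hs₀
    have hD₀ := hDpos hq₀off
    set D : ℝ := infDist q₀ arcs / 2 with hDdef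
    obtain ⟨ra, hra, hbvD⟩ := hD10 D (by positivity)
    -- continuity of the boundary curve at `s₀`
    obtain ⟨ε, hε, hεc⟩ := Metric.continuousAt_iff.1 (R.continuous_boundary.continuousAt (x := s₀)) (min (ra / 2) D) (by positivity)
    refine ⟨ε, hε, fun s hs hss₀ => ?_⟩
    have hd : dist (R.boundary s) q₀ < min (ra / 2) D := hεc (by rwa [Real.dist_eq])
    have hdra : dist (R.boundary s) q₀ < ra / 2 := hd.trans_le (min_le_left _ _)
    have hdD : dist (R.boundary s) q₀ < D := hd.trans_le (min_le_right _ _)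
    have hsoff := hoff i hi s hs
    -- the `D`-separation at `s₀` and at `s`
    have hsep₀ : ∀ y ∈ arcs, D ≤ dist q₀ y := fun y hy => by
      have := infDist_le_dist_of_mem (x := q₀) hy; rw [hDdef]; linarith [hD₀]
    have hseps : ∀ y ∈ arcs, D ≤ dist (R.boundary s) y := fun y hy => by
      have h1 := infDist_le_dist_of_mem (x := q₀) hy
      have h2 := dist_triangle q₀ (R.boundary s) y
      rw [dist_comm q₀ (R.boundary s)] at h2
      rw [hDdef] at hdD ⊢; linarith
    obtain ⟨U₀, c₀', hc₀', hbv₀, h3₀, -⟩ := hbvD s₀ hsep₀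
    obtain ⟨Us, cs, hcs, hbvs, -, h4s⟩ := hbvD s hseps
    -- eventually `cs n = c₀' n`
    have heq : ∀ᶠ n in atTop, cs n = c₀' n := by
      filter_upwards [h3₀, h4s] with n h3 h4
      obtain ⟨p, p', hpF, hpp', hp'F, ⟨j, hjsq, hjfr, hjq⟩, hval⟩ := h4
      rw [← hval]
      refine h3 p p' hpF hpp' hp'F ⟨j, hjsq, hjfr, ?_⟩
      linarith [dist_triangle j (R.boundary s) q₀]
    have hUeq : Us = U₀ := tendsto_nhds_unique hcs (hc₀'.congr' (heq.mono fun n hn => hn.symm))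
    rw [← hUuniq hsoff hbvs, ← hUuniq hq₀off hbv₀, hUeq]
  have hconst : ∀ i : Fin 4, (i = 1 ∨ i = 3) → ∀ s ∈ Ioo (R.mark i) (R.nextMark i), ∀ s' ∈ Ioo (R.mark i) (R.nextMark i),
      Ulim (R.boundary s) = Ulim (R.boundary s') := fun i hi s hs s' hs' =>
    eq_of_locallyConstant_Ioo (g := fun s => Ulim (R.boundary s)) (hloc i hi) hs hs'
  -- ### Step 8b: the jump across the crosscut
  obtain ⟨sb, hsb, hqb⟩ := hV0
  obtain ⟨st, hst, hqt⟩ := hV1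
  set Ubot : ℝ := Ulim (ΓV 0) with hUbot
  set Utop : ℝ := Ulim (ΓV 1) with hUtop
  have hqboff : ΓV 0 ∉ arcs := by rw [← hqb]; exact hoff 1 (Or.inl rfl) sb hsb
  have hqtoff : ΓV 1 ∉ arcs := by rw [← hqt]; exact hoff 3 (Or.inr rfl) st hst
  obtain ⟨rab, hrab, hbvb⟩ := hD10 _ (hDpos hqboff)
  obtain ⟨rat, hrat, hbvt⟩ := hD10 _ (hDpos hqtoff)
  obtain ⟨Ub, cb, hcb, hbvb', h3b, -⟩ := hbvb sb (by rw [hqb]; exact fun y hy => infDist_le_dist_of_mem hy)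
  obtain ⟨Ut, ct, hct, hbvt', h3t, -⟩ := hbvt st (by rw [hqt]; exact fun y hy => infDist_le_dist_of_mem hy)
  have hUb : Ub = Ubot := by rw [hUbot, ← hqb]; exact hUuniq (by rw [hqb]; exact hqboff) hbvb'
  have hUt : Ut = Utop := by rw [hUtop, ← hqt]; exact hUuniq (by rw [hqt]; exact hqtoff) hbvt'
  -- the exits of the crosscut loop
  obtain ⟨δ₀, hδ₀pos, hflux⟩ := exists_exits_flux_eq' R hVc hHc ⟨sb, hsb, hqb.symm⟩ ⟨st, hst, hqt.symm⟩
    (by obtain ⟨σ, hσ, e⟩ := hH0; exact ⟨σ, hσ, e.symm⟩) (by obtain ⟨σ, hσ, e⟩ := hH1; exact ⟨σ, hσ, e.symm⟩) hLR hVΩ hHΩ hr hball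
    htᵢ (htᵢ'.trans htₒ') htₒ hsᵢ (hsᵢ'.trans hsₒ') hsₒ hxs hys hdisjA hdisjB hA234 hB234 hVarc hEtc hEbc hMc hEt1 hEb1 hEt hEb hM hM0 hM1
    (η := min rab rat / 2) (by positivity)
  have hjump : ∀ᶠ n in atTop, ct n - cb n = (if jL = 0 then (1 : ℝ) else -1) *
      (effectiveConductance (discreteDomainGraph R.carrier (δ' n)) 1 (discreteArc R.carrier (δ' n) (R.arc 0)) (discreteArc R.carrier (δ' n) (R.arc 2))).toReal := by
    filter_upwards [h3b, h3t, (tendsto_order.1 hδ'0).2 _ (lt_min hδ₀pos (by positivity : (0 : ℝ) < min rab rat / 8))] with n h3b' h3t' hn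
    have hnδ₀ : δ' n < δ₀ := hn.trans_le (min_le_left _ _)
    have hn8 : δ' n < min rab rat / 8 := hn.trans_le (min_le_right _ _)
    have hfin : (discreteArc R.carrier (δ' n) (R.arc 0)).Finite := (meshDomain_finite R.isBounded (hδ' n)).subset fun x hx => hx.1.1
    have hdisjn : Disjoint (discreteArc R.carrier (δ' n) (R.arc 0)) (discreteArc R.carrier (δ' n) (R.arc 2)) :=
      Set.disjoint_iff_inter_eq_empty.2 (hdisj (φ n))
    obtain ⟨hbase, pb, nb, pt, nt, hpbnb, hptnt, hpbF, hptF, hnbF, hntF, ⟨wb, hwb, hwbd⟩, ⟨wt, hwt, hwtd⟩, hval⟩ :=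
      hflux (δ' n) (hδ' n) hnδ₀ (h (φ n)) hfin hdisjn (hharm n)
    rw [sum_divAt_eq_toReal_conductance' R (hδ' n) (hT n) (hB n) (hE n) (hharm n) hfin] at hval
    -- the exits are exits near `ΓV 0`, `ΓV 1`
    have hinner : ∀ {q : Site 2}, (faceGraph R.carrier (δ' n)).Reachable ![⌊xs / δ' n⌋, ⌊ys / δ' n⌋] q → IsInnerFace R.carrier (δ' n) q :=
      fun hq => by obtain ⟨W⟩ := hq; exact isInnerFace_of_mem_support' hbase W (Walk.end_mem_support _)
    have hnotinner : ∀ {p q : Site 2}, (faceGraph R.carrier (δ' n)).Reachable ![⌊xs / δ' n⌋, ⌊ys / δ' n⌋] p →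
        (zdGraph 2).Adj p q → ¬ (faceGraph R.carrier (δ' n)).Reachable ![⌊xs / δ' n⌋, ⌊ys / δ' n⌋] q → ¬ IsInnerFace R.carrier (δ' n) q :=
      fun hp hpq hq hqI => hq (hp.trans (faceGraph_adj_iff.2 ⟨hpq, hinner hp, hqI⟩).reachable)
    obtain ⟨jb, hjbsq, hjbfr⟩ := exists_mem_frontier_of_adj_not_isInnerFace R (hδ' n) (hinner hpbF) hpbnb (hnotinner hpbF hpbnb hnbF)
    obtain ⟨jt, hjtsq, hjtfr⟩ := exists_mem_frontier_of_adj_not_isInnerFace R (hδ' n) (hinner hptF) hptnt (hnotinner hptF hptnt hntF)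
    have hvb : faceExitVal R.carrier (δ' n) (h (φ n)) ![⌊xs / δ' n⌋, ⌊ys / δ' n⌋] pb nb = cb n := by
      refine h3b' pb nb hpbF hpbnb hnbF ⟨jb, hjbsq, hjbfr, ?_⟩
      rw [hqb]
      have := dist_le_of_mem_closedSq hjbsq hwb
      linarith [dist_triangle jb wb (ΓV 0), min_le_left rab rat]
    have hvt : faceExitVal R.carrier (δ' n) (h (φ n)) ![⌊xs / δ' n⌋, ⌊ys / δ' n⌋] pt nt = ct n := by
      refine h3t' pt nt hptF hptnt hntF ⟨jt, hjtsq, hjtfr, ?_⟩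
      rw [hqt]
      have := dist_le_of_mem_closedSq hjtsq hwt
      linarith [dist_triangle jt wt (ΓV 1), min_le_right rab rat]
    rw [← hvb, ← hvt, hval]
  have hUdiff : Utop - Ubot = (if jL = 0 then (1 : ℝ) else -1) * Ir := by
    rw [← hUb, ← hUt]
    refine tendsto_nhds_unique (hct.sub hcb) ?_
    exact (hCφr.const_mul _).congr' (hjump.mono fun n hn => hn.symm)
  have hUsq : (Utop - Ubot) ^ 2 = Ir ^ 2 := by
    rw [hUdiff]; split_ifs <;> ring
  -- ### Step 9: boundary values of `F = f ∘ Ψ` on the horizontal sides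
  set F : ℂ → ℂ := f ∘ Ψ with hF
  have hrect_sub : Ioo 0 a ×ℂ Ioo (0 : ℝ) b ⊆ Icc 0 a ×ℂ Icc 0 b := fun z hz => by
    rw [mem_reProdIm] at hz ⊢; exact ⟨Ioo_subset_Icc_self hz.1, Ioo_subset_Icc_self hz.2⟩
  have hside : ∀ x ∈ Ioo (0 : ℝ) a, ∀ (y₀ : ℝ), (y₀ = 0 ∨ y₀ = b) → ∀ U : ℝ, P (Ψ ((x : ℂ) + (y₀ : ℂ) * Complex.I)) U →
      ∀ ε > 0, ∃ θ > 0, ∀ y ∈ Ioo (0 : ℝ) b, |y - y₀| < θ → dist ((F ((x : ℂ) + (y : ℂ) * Complex.I)).re) U < ε := by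
    intro x hx y₀ hy₀ U hPU ε hε
    obtain ⟨r, hr, hrU⟩ := hPU (ε / 2) (by positivity)
    have hmem₀ : (x : ℂ) + (y₀ : ℂ) * Complex.I ∈ Icc 0 a ×ℂ Icc (0 : ℝ) b := by
      rw [mem_reProdIm]; simp only [add_re, ofReal_re, mul_re, I_re, mul_zero, ofReal_im, I_im, mul_one, sub_self, add_zero,
        add_im, mul_im, zero_add]
      exact ⟨Ioo_subset_Icc_self hx, by rcases hy₀ with rfl | rfl <;> [exact ⟨le_rfl, hb.le⟩; exact ⟨hb.le, le_rfl⟩]⟩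
    obtain ⟨θ, hθ, hθc⟩ := Metric.continuousWithinAt_iff.1 (hΨc _ hmem₀) r hr
    refine ⟨θ, hθ, fun y hy hyy₀ => ?_⟩
    have hmem : (x : ℂ) + (y : ℂ) * Complex.I ∈ Ioo 0 a ×ℂ Ioo (0 : ℝ) b := by
      rw [mem_reProdIm]; simpa using ⟨hx, hy⟩
    have hΩmem : Ψ ((x : ℂ) + (y : ℂ) * Complex.I) ∈ R.carrier := by rw [← hΨimg]; exact mem_image_of_mem Ψ hmem
    have hd : dist ((x : ℂ) + (y : ℂ) * Complex.I) ((x : ℂ) + (y₀ : ℂ) * Complex.I) < θ := by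
      rw [dist_eq_norm, show (x : ℂ) + (y : ℂ) * Complex.I - ((x : ℂ) + (y₀ : ℂ) * Complex.I) = ((y - y₀ : ℝ) : ℂ) * Complex.I by push_cast; ring,
        norm_mul, norm_I, mul_one, norm_real, Real.norm_eq_abs]
      exact hyy₀
    have := hrU _ hΩmem (hθc (hrect_sub hmem) hd)
    rw [Real.dist_eq]
    exact lt_of_le_of_lt this (by linarith)
  have hbot : ∀ x ∈ Ioo (0 : ℝ) a, Tendsto (fun y : ℝ => (F ((x : ℂ) + (y : ℂ) * Complex.I)).re) (𝓝[>] 0) (𝓝 Ubot) := by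
    intro x hx
    have hq : Ψ ((x : ℂ) + ((0 : ℝ) : ℂ) * Complex.I) ∈ openArc R 1 := by
      refine hBo (mem_image_of_mem Ψ ?_)
      rw [mem_reProdIm]; simpa using hx
    obtain ⟨sx, hsx, hqx⟩ := hq
    have hoffx := hoff 1 (Or.inl rfl) sx hsx
    have hPx : P (Ψ ((x : ℂ) + ((0 : ℝ) : ℂ) * Complex.I)) Ubot := by
      rw [← hqx, hUbot, ← hqb, ← hconst 1 (Or.inl rfl) sx hsx sb hsb]; exact hUlimP hoffx
    rw [Metric.tendsto_nhdsWithin_nhds]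
    intro ε hε
    obtain ⟨θ, hθ, hθU⟩ := hside x hx 0 (Or.inl rfl) Ubot hPx ε hε
    refine ⟨min θ b, by positivity, fun y hy hyd => hθU y ⟨hy, ?_⟩ ?_⟩
    · rw [Real.dist_eq, sub_zero, abs_of_pos hy] at hyd; exact hyd.trans_le (min_le_right _ _)
    · rw [Real.dist_eq] at hyd; exact hyd.trans_le (min_le_left _ _)
  have htop : ∀ x ∈ Ioo (0 : ℝ) a, Tendsto (fun y : ℝ => (F ((x : ℂ) + (y : ℂ) * Complex.I)).re) (𝓝[<] b) (𝓝 Utop) := by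
    intro x hx
    have hq : Ψ ((x : ℂ) + ((b : ℝ) : ℂ) * Complex.I) ∈ openArc R 3 := by
      refine hTo (mem_image_of_mem Ψ ?_)
      rw [mem_reProdIm]; simpa using hx
    obtain ⟨sx, hsx, hqx⟩ := hq
    have hoffx := hoff 3 (Or.inr rfl) sx hsx
    have hPx : P (Ψ ((x : ℂ) + ((b : ℝ) : ℂ) * Complex.I)) Utop := by
      rw [← hqx, hUtop, ← hqt, ← hconst 3 (Or.inr rfl) sx hsx st hst]; exact hUlimP hoffx
    rw [Metric.tendsto_nhdsWithin_nhds]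
    intro ε hε
    obtain ⟨θ, hθ, hθU⟩ := hside x hx b (Or.inr rfl) Utop hPx ε hε
    refine ⟨min θ b, by positivity, fun y hy hyd => hθU y ⟨?_, hy⟩ ?_⟩
    · rw [Real.dist_eq, abs_sub_comm, abs_of_pos (by simpa using hy)] at hyd
      linarith [min_le_right θ b]
    · rw [Real.dist_eq] at hyd; exact hyd.trans_le (min_le_left _ _)
  -- ### Step 10: the rectangle energy inequality and the change of variables
  have hopen : IsOpen (Ioo 0 a ×ℂ Ioo (0 : ℝ) b) := isOpen_Ioo.reProdIm isOpen_Ioo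
  have hFd : DifferentiableOn ℂ F (Ioo 0 a ×ℂ Ioo 0 b) :=
    hfd.comp hΨd fun z hz => by rw [← hΨimg]; exact mem_image_of_mem Ψ hz
  have hE2 := ofReal_sq_sub_mul_div_le_lintegral_rect ha hb hFd hbot htop
  have hcov : ∫⁻ z in Ioo 0 a ×ℂ Ioo 0 b, ‖deriv F z‖ₑ ^ 2 = ∫⁻ w in R.carrier, ‖deriv f w‖ₑ ^ 2 := by
    have := lintegral_deriv_comp_sq_eq (f := f) hopen hΨd (hΨinj.mono hrect_sub) (by rw [hΨimg]; exact hΩo) (by rw [hΨimg]; exact hfd)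
    rwa [hΨimg] at this
  rw [hUsq, hcov] at hE2
  have hfinal : ENNReal.ofReal (Ir ^ 2 * a / b) ≤ ENNReal.ofReal Ir := by rw [← hIr]; exact hE2.trans hfint
  -- ### Step 11: conclusion
  have hIrle : Ir ≤ b / a := by
    rw [ENNReal.ofReal_le_ofReal_iff hIr0] at hfinal
    rcases hIr0.eq_or_lt with h0' | hpos
    · rw [← h0']; positivity
    · have h1 : Ir * (Ir * a / b) ≤ Ir * 1 := by rw [mul_one]; calc Ir * (Ir * a / b) = Ir ^ 2 * a / b := by ring
        _ ≤ Ir := hfinal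
      have h2 : Ir * a / b ≤ 1 := le_of_mul_le_mul_left h1 hpos
      rw [div_le_one hb] at h2
      rw [le_div_iff₀ ha]; linarith
  calc I = ENNReal.ofReal Ir := hIr
    _ ≤ ENNReal.ofReal (b / a) := ENNReal.ofReal_le_ofReal hIrle
    _ = (ENNReal.ofReal (a / b))⁻¹ := by
        rw [← ENNReal.ofReal_inv_of_pos (by positivity : (0 : ℝ) < a / b), inv_div]
    _ ≤ (Literature.Analysis.Complex.extremalDistance R.carrier (R.arc 0) (R.arc 2))⁻¹ := ENNReal.inv_le_inv.2 hlam

end KirchhoffSlope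

end Summit.CriticalPhenomena.CardyFormulaZ2.Theorems
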